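import Summits.CriticalPhenomena.CardyFormulaZ2.Theorems.CardyFlipRussoQuadrupoleSelectionRulePoissonPartialRotation
import Literature.Analysis.FunctionSpaces.PoissonPointProcessUniqueness

/-!
# The partial-rotation symmetry of the Poisson hub (card A, Poisson instance)

Helper file for the crux `QuadrupoleSelectionRule` (stmt-CriticalPhenomena-7029, informal) of route
`CardyFlipRusso` (sub-problem `CardyFormulaZ2`), line `Sketch`: the card statement
`PoissonPartialRotationInvariance` of idea card `average-first-odd-sector-gap`, from the landed
stub S4 (`isPoissonPointProcess_map_partialRotation`, the Mapping Theorem for the piecewise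
rotation) and Rényi–Kingman uniqueness of the Poisson law with given σ-finite intensity
(`IsPoissonPointProcess.unique_holds`, proved in
`Literature/Analysis/FunctionSpaces/PoissonPointProcessUniqueness.lean`).
-/

noncomputable section

open MeasureTheory ProbabilityTheory

namespace Summit.CriticalPhenomena.CardyFormulaZ2.Theorems

open Literature.Analysis.FunctionSpaces

/-- **Card A, Poisson instance (`PoissonPartialRotationInvariance`).** For a Poisson point
process `P` of Lebesgue intensity on `ℂ`, every measurable map `Φ` of configurations acting as
"rotate the points inside the open disc `B(z,r)` by the angle `θ` about `z`, keep the points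
outside" (characterised through the counting maps) preserves the law, `P.map Φ = P` — for EVERY
angle `θ`, centre `z` and radius `r`: the Mapping Theorem (the partial rotation preserves Lebesgue
measure) followed by uniqueness of the Poisson law of given intensity. [folklore] -/
theorem poisson_map_partialRotation_eq (P : Measure (PointConfig ℂ)) (z : ℂ) (r θ : ℝ)
    (Φ : PointConfig ℂ → PointConfig ℂ) (hP : IsPoissonPointProcess (volume : Measure ℂ) P)
    (hΦ : Measurable Φ)
    (hcount : ∀ (c : PointConfig ℂ) (s : Set ℂ), MeasurableSet s →
      (Φ c).count s = c.count ((fun w : ℂ => if dist w z < r then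
        z + Complex.exp ((θ : ℂ) * Complex.I) * (w - z) else w) ⁻¹' s)) :
    P.map Φ = P :=
  (IsPoissonPointProcess.unique_holds hP
    (isPoissonPointProcess_map_partialRotation P z r θ Φ hP hΦ hcount)).symm

end Summit.CriticalPhenomena.CardyFormulaZ2.Theorems

end
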